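import Literature.Computability.Complexity.HardcoreInapproximabilityProofs
import HarnessLib

/-!
# Planting cycles in Sly's random bipartite core: the per-colour asymptotics (towards Lemma 3.8)

Allan Sly, *Computational transition at the uniqueness threshold*, FOCS 2010 (arXiv:1005.5584), §3.2
(Lemma 3.8, the ratio `P2/P3`), via the binomial perturbation Lemma 3.2 (`abs_log_choose_sub_le`).

Prescribing `e` edges of one colour class, `f⁺` of them with an occupied plus end and `f⁻` with an
occupied minus end, changes the avoidance probability of that colour by the factor
`[C(N-e-(b'-f⁻), a'-f⁺)/C(N-e, a'-f⁺)] / [C(N-b', a')/C(N, a')]`. This file proves, with explicit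
error terms valid in the whole phase window:

* `planted_colour_logratio`: the logarithm of this factor is `log slyColourLimit (a'/N) (b'/N) e f⁺ f⁻`
  up to `32 e²/min(a', N-a'-b')`, where `slyColourLimit α β e f⁺ f⁻ = (1-β)^{f⁻-e} (1-α-β)^{e-f⁺-f⁻} (1-α)^{f⁺-e}`
  (Sly's displayed limit of `P2/P3`, one colour; the main terms cancel exactly);
* `abs_log_descFactorial_sub_le` (`1/N^{(e)}` versus `N^{-e}`), `abs_log_traceCount_sub_le`
  (`C(n-J, a-j)/C(n,a)` versus `α^j (1-α)^{J-j}`), `abs_log_one_sub_sub_le` (moving densities);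
* `overlap_colour_choose_ratio_le`, `one_div_descFactorial_le`: the cruder one-sided bounds used for
  overlapping configurations (`f⁺ = f⁻ = e`, limit `(1-α-β)^{-e}`).

No named facts. [cite: Sly2010, Lemma 3.8; Lemma 3.2]
-/

namespace Literature.Computability.Complexity

open Finset

section ColourRatio

/-- The limiting per-colour factor `(1-β)^{f⁻-e} (1-α-β)^{e-f⁺-f⁻} (1-α)^{f⁺-e}`, written with natural
exponents. [cite: Sly2010, Lemma 3.8 (proof: the limit of `P2/P3`)] -/
noncomputable def slyColourLimit (α β : ℝ) (e fp fm : ℕ) : ℝ :=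
  ((1 - β) ^ fm * (1 - α) ^ fp * (1 - α - β) ^ e) / ((1 - α - β) ^ (fp + fm) * (1 - α) ^ e * (1 - β) ^ e)

/-- **Per-colour planted/unplanted ratio** (Sly's `P2/P3`, one colour class, via Lemma 3.2 twice): with
`N' = N`, `e` prescribed edges of which `f⁺` have an occupied plus end and `f⁻` an occupied minus end,
`a'` occupied plus and `b'` occupied minus vertices,
`|log( [C(N-e-(b'-f⁻), a'-f⁺)/C(N-e, a'-f⁺)] / [C(N-b', a')/C(N, a')] ) - log L| ≤ 32 e²/m`,
`L = slyColourLimit (a'/N) (b'/N) e f⁺ f⁻`, `m = min(a', N-a'-b')`, whenever `4e ≤ m`.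
[cite: Sly2010, Lemma 3.8 (proof: `P2/P3 = (1+o(1)) (1-β-α)^{i-2j₋-2j₊}/((1-α)^{i-2j₊}(1-β)^{i-2j₋})`)] -/
theorem planted_colour_logratio (N e fp fm a' b' : ℕ) (hfp : fp ≤ e) (hfm : fm ≤ e) (hfmb : fm ≤ b')
    (ha0 : 0 < a') (ha : 4 * e ≤ a') (hgap : 4 * e ≤ N - a' - b') (hab : a' + b' < N) :
    |(Real.log (((N - e - (b' - fm)).choose (a' - fp) : ℕ) : ℝ) - Real.log (((N - e).choose (a' - fp) : ℕ) : ℝ)) -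
        (Real.log (((N - b').choose a' : ℕ) : ℝ) - Real.log ((N.choose a' : ℕ) : ℝ)) -
        Real.log (slyColourLimit ((a' : ℝ) / N) ((b' : ℝ) / N) e fp fm)| ≤
      32 * (e : ℝ) ^ 2 / min (a' : ℝ) ((N : ℝ) - a' - b') := by
  -- positivity bookkeeping
  have hN : a' + b' < N := hab
  have hNr : (0 : ℝ) < N := by exact_mod_cast (show 0 < N by omega)
  have har : (0 : ℝ) < a' := by exact_mod_cast ha0
  have hgapr : (0 : ℝ) < (N : ℝ) - a' - b' := by
    have : ((a' + b' : ℕ) : ℝ) < N := by exact_mod_cast hN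
    push_cast at this; linarith
  have hmpos : (0 : ℝ) < min (a' : ℝ) ((N : ℝ) - a' - b') := lt_min har hgapr
  -- first application: `(a, b) = (N - b', a')` perturbed by `(f⁻ - e, -f⁺)`
  have h1 := abs_log_choose_sub_le (N - b') a' (N - e - (b' - fm)) (a' - fp) ha0 (by omega)
    (by
      have : ((N - e - (b' - fm) : ℕ) : ℝ) - ((N - b' : ℕ) : ℝ) = (fm : ℝ) - e := by
        rw [Nat.cast_sub (by omega), Nat.cast_sub (by omega), Nat.cast_sub (by omega), Nat.cast_sub (by omega)]; ring
      rw [this]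
      have hfm' : (fm : ℝ) ≤ e := by exact_mod_cast hfm
      have hfm0 : (0 : ℝ) ≤ fm := Nat.cast_nonneg fm
      have he0 : (0 : ℝ) ≤ e := Nat.cast_nonneg e
      have hx : |(fm : ℝ) - e| ≤ e := by
        rw [abs_le]; constructor <;> linarith
      apply le_min
      · have : (4 * e : ℕ) ≤ (a' : ℝ) := by exact_mod_cast ha
        push_cast at this; linarith [hx]
      · have h' : ((4 * e : ℕ) : ℝ) ≤ ((N - a' - b' : ℕ) : ℝ) := by exact_mod_cast hgap
        push_cast at h'
        rw [Nat.cast_sub (by omega), Nat.cast_sub (by omega)] at h'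
        rw [Nat.cast_sub (by omega)]
        linarith [hx])
    (by
      have : ((a' - fp : ℕ) : ℝ) - (a' : ℝ) = -(fp : ℝ) := by rw [Nat.cast_sub (by omega)]; ring
      rw [this, abs_neg, abs_of_nonneg (Nat.cast_nonneg fp)]
      have hfpr : (fp : ℝ) ≤ e := by exact_mod_cast hfp
      apply le_min
      · have : (4 * e : ℕ) ≤ (a' : ℝ) := by exact_mod_cast ha
        push_cast at this; linarith
      · have h' : ((4 * e : ℕ) : ℝ) ≤ ((N - a' - b' : ℕ) : ℝ) := by exact_mod_cast hgap
        push_cast at h'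
        rw [Nat.cast_sub (by omega), Nat.cast_sub (by omega)] at h'
        rw [Nat.cast_sub (by omega)]
        linarith)
  -- second application: `(a, b) = (N, a')` perturbed by `(-e, -f⁺)`
  have h2 := abs_log_choose_sub_le N a' (N - e) (a' - fp) ha0 (by omega)
    (by
      have : ((N - e : ℕ) : ℝ) - (N : ℝ) = -(e : ℝ) := by rw [Nat.cast_sub (by omega)]; ring
      rw [this, abs_neg, abs_of_nonneg (Nat.cast_nonneg e)]
      apply le_min
      · have : (4 * e : ℕ) ≤ (a' : ℝ) := by exact_mod_cast ha
        push_cast at this; linarith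
      · have h' : ((4 * e : ℕ) : ℝ) ≤ ((N - a' - b' : ℕ) : ℝ) := by exact_mod_cast hgap
        push_cast at h'
        rw [Nat.cast_sub (by omega), Nat.cast_sub (by omega)] at h'
        linarith [Nat.cast_nonneg (α := ℝ) b'])
    (by
      have : ((a' - fp : ℕ) : ℝ) - (a' : ℝ) = -(fp : ℝ) := by rw [Nat.cast_sub (by omega)]; ring
      rw [this, abs_neg, abs_of_nonneg (Nat.cast_nonneg fp)]
      have hfpr : (fp : ℝ) ≤ e := by exact_mod_cast hfp
      apply le_min
      · have : (4 * e : ℕ) ≤ (a' : ℝ) := by exact_mod_cast ha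
        push_cast at this; linarith
      · have h' : ((4 * e : ℕ) : ℝ) ≤ ((N - a' - b' : ℕ) : ℝ) := by exact_mod_cast hgap
        push_cast at h'
        rw [Nat.cast_sub (by omega), Nat.cast_sub (by omega)] at h'
        linarith [Nat.cast_nonneg (α := ℝ) b'])
  -- rewrite the perturbations in `h1`, `h2`
  have hx1 : ((N - e - (b' - fm) : ℕ) : ℝ) - ((N - b' : ℕ) : ℝ) = (fm : ℝ) - e := by
    rw [Nat.cast_sub (by omega), Nat.cast_sub (by omega), Nat.cast_sub (by omega), Nat.cast_sub (by omega)]; ring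
  have hy1 : ((a' - fp : ℕ) : ℝ) - (a' : ℝ) = -(fp : ℝ) := by rw [Nat.cast_sub (by omega)]; ring
  have hx2 : ((N - e : ℕ) : ℝ) - (N : ℝ) = -(e : ℝ) := by rw [Nat.cast_sub (by omega)]; ring
  have hPb : ((N - b' : ℕ) : ℝ) = (N : ℝ) - b' := by rw [Nat.cast_sub (by omega)]
  rw [hx1, hy1, hPb] at h1
  rw [hx2, hy1] at h2
  -- the positive quantities `N - b'`, `N - a' - b'`, `N - a'`
  have hPpos : (0 : ℝ) < (N : ℝ) - b' := by linarith
  have hQpos : (0 : ℝ) < (N : ℝ) - a' - b' := hgapr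
  have hRpos : (0 : ℝ) < (N : ℝ) - a' := by linarith [Nat.cast_nonneg (α := ℝ) b']
  have hPQ : (N : ℝ) - b' - (a' : ℝ) = (N : ℝ) - a' - b' := by ring
  rw [hPQ] at h1
  -- the limit in terms of `log (N-b'), log (N-a'-b'), log (N-a'), log a', log N`
  have hlogL : Real.log (slyColourLimit ((a' : ℝ) / N) ((b' : ℝ) / N) e fp fm) =
      (fm : ℝ) * (Real.log ((N : ℝ) - b') - Real.log N) + fp * (Real.log ((N : ℝ) - a') - Real.log N) +
          e * (Real.log ((N : ℝ) - a' - b') - Real.log N) -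
        (((fp : ℝ) + fm) * (Real.log ((N : ℝ) - a' - b') - Real.log N) + e * (Real.log ((N : ℝ) - a') - Real.log N) +
          e * (Real.log ((N : ℝ) - b') - Real.log N)) := by
    unfold slyColourLimit
    have hu1 : (1 : ℝ) - (b' : ℝ) / N = ((N : ℝ) - b') / N := by field_simp
    have hu2 : (1 : ℝ) - (a' : ℝ) / N = ((N : ℝ) - a') / N := by field_simp
    have hu3 : (1 : ℝ) - (a' : ℝ) / N - (b' : ℝ) / N = ((N : ℝ) - a' - b') / N := by field_simp
    rw [hu3, hu1, hu2]
    have hPN : 0 < ((N : ℝ) - b') / N := div_pos hPpos hNr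
    have hQN : 0 < ((N : ℝ) - a' - b') / N := div_pos hQpos hNr
    have hRN : 0 < ((N : ℝ) - a') / N := div_pos hRpos hNr
    have l1 : Real.log (((N : ℝ) - b') / N) = Real.log ((N : ℝ) - b') - Real.log N := Real.log_div hPpos.ne' hNr.ne'
    have l2 : Real.log (((N : ℝ) - a') / N) = Real.log ((N : ℝ) - a') - Real.log N := Real.log_div hRpos.ne' hNr.ne'
    have l3 : Real.log (((N : ℝ) - a' - b') / N) = Real.log ((N : ℝ) - a' - b') - Real.log N := Real.log_div hQpos.ne' hNr.ne'
    rw [Real.log_div (by positivity) (by positivity)]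
    rw [Real.log_mul (by positivity) (by positivity), Real.log_mul (by positivity) (by positivity)]
    rw [Real.log_mul (by positivity) (by positivity), Real.log_mul (by positivity) (by positivity)]
    simp only [Real.log_pow]
    rw [l1, l2, l3]
    push_cast
    ring
  -- the main terms cancel exactly
  have hlogs : ((fm : ℝ) - e) * Real.log (((N : ℝ) - b') / ((N : ℝ) - a' - b')) + -(fp : ℝ) * Real.log (((N : ℝ) - a' - b') / a') -
      (-(e : ℝ) * Real.log ((N : ℝ) / ((N : ℝ) - a')) + -(fp : ℝ) * Real.log (((N : ℝ) - a') / a')) =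
      Real.log (slyColourLimit ((a' : ℝ) / N) ((b' : ℝ) / N) e fp fm) := by
    rw [hlogL, Real.log_div hPpos.ne' hQpos.ne', Real.log_div hQpos.ne' har.ne', Real.log_div hNr.ne' hRpos.ne',
      Real.log_div hRpos.ne' har.ne']
    ring
  -- sizes of the perturbations
  have he0 : (0 : ℝ) ≤ e := Nat.cast_nonneg e
  have hfm' : (fm : ℝ) ≤ e := by exact_mod_cast hfm
  have hfp' : (fp : ℝ) ≤ e := by exact_mod_cast hfp
  have hfm0 : (0 : ℝ) ≤ fm := Nat.cast_nonneg fm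
  have hfp0 : (0 : ℝ) ≤ fp := Nat.cast_nonneg fp
  have hfp2 : (-(fp : ℝ)) ^ 2 ≤ (e : ℝ) ^ 2 := by
    rw [neg_sq]; exact pow_le_pow_left₀ hfp0 hfp' 2
  have hfm2 : ((fm : ℝ) - e) ^ 2 ≤ (e : ℝ) ^ 2 := by
    rw [show ((fm : ℝ) - e) ^ 2 = ((e : ℝ) - fm) ^ 2 by ring]
    exact pow_le_pow_left₀ (by linarith) (by linarith) 2
  have he2 : (-(e : ℝ)) ^ 2 = (e : ℝ) ^ 2 := neg_sq _
  have hs1 : 8 * (((fm : ℝ) - e) ^ 2 + (-(fp : ℝ)) ^ 2) ≤ 16 * (e : ℝ) ^ 2 := by linarith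
  have hs2 : 8 * ((-(e : ℝ)) ^ 2 + (-(fp : ℝ)) ^ 2) ≤ 16 * (e : ℝ) ^ 2 := by linarith
  -- the second denominator is larger
  have hm2 : min (a' : ℝ) ((N : ℝ) - a' - b') ≤ min (a' : ℝ) ((N : ℝ) - a') :=
    min_le_min le_rfl (by linarith [Nat.cast_nonneg (α := ℝ) b'])
  have hb1 : 8 * (((fm : ℝ) - e) ^ 2 + (-(fp : ℝ)) ^ 2) / min (a' : ℝ) ((N : ℝ) - a' - b') ≤
      16 * (e : ℝ) ^ 2 / min (a' : ℝ) ((N : ℝ) - a' - b') := div_le_div_of_nonneg_right hs1 hmpos.le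
  have hb2 : 8 * ((-(e : ℝ)) ^ 2 + (-(fp : ℝ)) ^ 2) / min (a' : ℝ) ((N : ℝ) - a') ≤ 16 * (e : ℝ) ^ 2 / min (a' : ℝ) ((N : ℝ) - a' - b') :=
    (div_le_div_of_nonneg_left (by positivity) hmpos hm2).trans (div_le_div_of_nonneg_right hs2 hmpos.le)
  -- combine
  rw [← hlogs]
  have heq : Real.log (((N - e - (b' - fm)).choose (a' - fp) : ℕ) : ℝ) - Real.log (((N - e).choose (a' - fp) : ℕ) : ℝ) -
        (Real.log (((N - b').choose a' : ℕ) : ℝ) - Real.log ((N.choose a' : ℕ) : ℝ)) -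
        (((fm : ℝ) - e) * Real.log (((N : ℝ) - b') / ((N : ℝ) - a' - b')) + -(fp : ℝ) * Real.log (((N : ℝ) - a' - b') / a') -
          (-(e : ℝ) * Real.log ((N : ℝ) / ((N : ℝ) - a')) + -(fp : ℝ) * Real.log (((N : ℝ) - a') / a'))) =
      (Real.log (((N - e - (b' - fm)).choose (a' - fp) : ℕ) : ℝ) - Real.log (((N - b').choose a' : ℕ) : ℝ) -
          ((fm : ℝ) - e) * Real.log (((N : ℝ) - b') / ((N : ℝ) - a' - b')) - -(fp : ℝ) * Real.log (((N : ℝ) - a' - b') / a')) -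
        (Real.log (((N - e).choose (a' - fp) : ℕ) : ℝ) - Real.log ((N.choose a' : ℕ) : ℝ) -
          -(e : ℝ) * Real.log ((N : ℝ) / ((N : ℝ) - a')) - -(fp : ℝ) * Real.log (((N : ℝ) - a') / a')) := by ring
  rw [heq]
  have h32 : 32 * (e : ℝ) ^ 2 / min (a' : ℝ) ((N : ℝ) - a' - b') =
      16 * (e : ℝ) ^ 2 / min (a' : ℝ) ((N : ℝ) - a' - b') + 16 * (e : ℝ) ^ 2 / min (a' : ℝ) ((N : ℝ) - a' - b') := by ring
  rw [h32]
  exact (abs_sub _ _).trans (add_le_add (h1.trans hb1) (h2.trans hb2))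

end ColourRatio

section SmallFactors

/-- **The cost of prescribing `e` edges**: `|log N^{(e)} - e log N| ≤ 2e²/N` (`2e ≤ N`). [folklore] -/
theorem abs_log_descFactorial_sub_le (N e : ℕ) (hN : 0 < N) (he : 2 * e ≤ N) :
    |Real.log (N.descFactorial e : ℝ) - e * Real.log N| ≤ 2 * (e : ℝ) ^ 2 / N := by
  have h := log_factorial_sub_sub_mem N e hN he
  have hsplit : Real.log (N.descFactorial e : ℝ) = Real.log (N.factorial : ℝ) - Real.log ((N - e).factorial : ℝ) := by
    have hfac : ((N - e).factorial : ℝ) * (N.descFactorial e : ℝ) = (N.factorial : ℝ) := by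
      exact_mod_cast Nat.factorial_mul_descFactorial (by omega : e ≤ N)
    have h1 : (0 : ℝ) < (N - e).factorial := by exact_mod_cast Nat.factorial_pos _
    have h2 : (0 : ℝ) < N.descFactorial e := by exact_mod_cast Nat.descFactorial_pos.2 (by omega)
    rw [← hfac, Real.log_mul h1.ne' h2.ne']
    ring
  rw [hsplit, abs_le]
  constructor <;> linarith [h.1, h.2]

/-- **The trace-count factor**: `|log (C(n-J, a-j)/C(n, a)) - log (αʲ (1-α)^{J-j})| ≤ 16 J²/min(a, n-a)`
with `α = a/n`, for `j ≤ J`, `4J ≤ min(a, n - a)`. [cite: Sly2010, Lemma 3.8 (proof: the number of configurations `Υ` compatible with `ξ`)] -/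
theorem abs_log_traceCount_sub_le (n a J j : ℕ) (hj : j ≤ J) (ha0 : 0 < a) (ha : 4 * J ≤ a) (hna : 4 * J ≤ n - a) (han : a < n) :
    |Real.log (((n - J).choose (a - j) : ℕ) : ℝ) - Real.log ((n.choose a : ℕ) : ℝ) -
        Real.log (((a : ℝ) / n) ^ j * (1 - (a : ℝ) / n) ^ (J - j))| ≤ 16 * (J : ℝ) ^ 2 / min (a : ℝ) ((n : ℝ) - a) := by
  have hnr : (0 : ℝ) < n := by exact_mod_cast (show 0 < n by omega)
  have har : (0 : ℝ) < a := by exact_mod_cast ha0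
  have hnar : (0 : ℝ) < (n : ℝ) - a := by
    have : (a : ℝ) < n := by exact_mod_cast han
    linarith
  have hm : (0 : ℝ) < min (a : ℝ) ((n : ℝ) - a) := lt_min har hnar
  have hJ0 : (0 : ℝ) ≤ J := Nat.cast_nonneg J
  have hjr : (j : ℝ) ≤ J := by exact_mod_cast hj
  have hj0 : (0 : ℝ) ≤ j := Nat.cast_nonneg j
  have h := abs_log_choose_sub_le n a (n - J) (a - j) ha0 han
    (by
      have : ((n - J : ℕ) : ℝ) - (n : ℝ) = -(J : ℝ) := by rw [Nat.cast_sub (by omega)]; ring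
      rw [this, abs_neg, abs_of_nonneg hJ0]
      apply le_min
      · have : ((4 * J : ℕ) : ℝ) ≤ a := by exact_mod_cast ha
        push_cast at this; linarith
      · have h' : ((4 * J : ℕ) : ℝ) ≤ ((n - a : ℕ) : ℝ) := by exact_mod_cast hna
        push_cast at h'; rw [Nat.cast_sub han.le] at h'; linarith)
    (by
      have : ((a - j : ℕ) : ℝ) - (a : ℝ) = -(j : ℝ) := by rw [Nat.cast_sub (by omega)]; ring
      rw [this, abs_neg, abs_of_nonneg hj0]
      apply le_min
      · have : ((4 * J : ℕ) : ℝ) ≤ a := by exact_mod_cast ha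
        push_cast at this; linarith
      · have h' : ((4 * J : ℕ) : ℝ) ≤ ((n - a : ℕ) : ℝ) := by exact_mod_cast hna
        push_cast at h'; rw [Nat.cast_sub han.le] at h'; linarith)
  have hx : ((n - J : ℕ) : ℝ) - (n : ℝ) = -(J : ℝ) := by rw [Nat.cast_sub (by omega)]; ring
  have hy : ((a - j : ℕ) : ℝ) - (a : ℝ) = -(j : ℝ) := by rw [Nat.cast_sub (by omega)]; ring
  rw [hx, hy] at h
  -- the main terms: `-J log(n/(n-a)) - j log((n-a)/a) = log(α^j (1-α)^{J-j})`
  have hmain : -(J : ℝ) * Real.log ((n : ℝ) / ((n : ℝ) - a)) + -(j : ℝ) * Real.log (((n : ℝ) - a) / a) =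
      Real.log (((a : ℝ) / n) ^ j * (1 - (a : ℝ) / n) ^ (J - j)) := by
    have h1a : (1 : ℝ) - (a : ℝ) / n = ((n : ℝ) - a) / n := by field_simp
    rw [h1a, Real.log_mul (by positivity) (by positivity), Real.log_pow, Real.log_pow, Real.log_div har.ne' hnr.ne',
      Real.log_div hnar.ne' hnr.ne', Real.log_div hnr.ne' hnar.ne', Real.log_div hnar.ne' har.ne', Nat.cast_sub hj]
    ring
  rw [← hmain]
  have hs : 8 * ((-(J : ℝ)) ^ 2 + (-(j : ℝ)) ^ 2) ≤ 16 * (J : ℝ) ^ 2 := by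
    rw [neg_sq, neg_sq]
    have : (j : ℝ) ^ 2 ≤ (J : ℝ) ^ 2 := pow_le_pow_left₀ hj0 hjr 2
    linarith
  have heq : Real.log (((n - J).choose (a - j) : ℕ) : ℝ) - Real.log ((n.choose a : ℕ) : ℝ) -
      (-(J : ℝ) * Real.log ((n : ℝ) / ((n : ℝ) - a)) + -(j : ℝ) * Real.log (((n : ℝ) - a) / a)) =
      Real.log (((n - J).choose (a - j) : ℕ) : ℝ) - Real.log ((n.choose a : ℕ) : ℝ) -
        -(J : ℝ) * Real.log ((n : ℝ) / ((n : ℝ) - a)) - -(j : ℝ) * Real.log (((n : ℝ) - a) / a) := by ring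
  rw [heq]
  exact h.trans (div_le_div_of_nonneg_right hs hm.le)

/-- **Lipschitz dependence of the colour limit on the densities** (to move the `σ`-colour densities
`(a+|E⁺|)/(n+m')` to `a/n`): `|log(1 - x') - log(1 - x)| ≤ |x' - x|/m` when `1 - x, 1 - x' ≥ m > 0`. [folklore] -/
theorem abs_log_one_sub_sub_le {x x' m : ℝ} (hm : 0 < m) (hx : m ≤ 1 - x) (hx' : m ≤ 1 - x') :
    |Real.log (1 - x') - Real.log (1 - x)| ≤ |x' - x| / m := by
  -- mean value / monotonicity of `log`: `log u' - log u` lies between `(u'-u)/u'` and `(u'-u)/u`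
  have hu : 0 < 1 - x := hm.trans_le hx
  have hu' : 0 < 1 - x' := hm.trans_le hx'
  have h1 : Real.log (1 - x') - Real.log (1 - x) ≤ ((1 - x') - (1 - x)) / (1 - x) := by
    have := Real.log_le_sub_one_of_pos (div_pos hu' hu)
    rw [Real.log_div hu'.ne' hu.ne'] at this
    rw [div_sub_one hu.ne'] at this
    exact this
  have h2 : ((1 - x') - (1 - x)) / (1 - x') ≤ Real.log (1 - x') - Real.log (1 - x) := by
    have := Real.log_le_sub_one_of_pos (div_pos hu hu')
    rw [Real.log_div hu.ne' hu'.ne', div_sub_one hu'.ne'] at this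
    have e1 : ((1 - x) - (1 - x')) / (1 - x') = -(((1 - x') - (1 - x)) / (1 - x')) := by ring
    linarith [e1]
  rw [abs_le]
  constructor
  · -- lower bound
    have : -(|x' - x| / m) ≤ ((1 - x') - (1 - x)) / (1 - x') := by
      rw [show (1 - x') - (1 - x) = -(x' - x) by ring, neg_div, neg_le_neg_iff]
      calc (x' - x) / (1 - x') ≤ |x' - x| / (1 - x') := div_le_div_of_nonneg_right (le_abs_self _) hu'.le
        _ ≤ |x' - x| / m := div_le_div_of_nonneg_left (abs_nonneg _) hm hx'
    linarith
  · have : ((1 - x') - (1 - x)) / (1 - x) ≤ |x' - x| / m := by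
      rw [show (1 - x') - (1 - x) = -(x' - x) by ring, neg_div]
      calc -((x' - x) / (1 - x)) ≤ |x' - x| / (1 - x) := by
            rw [← neg_div]; exact div_le_div_of_nonneg_right (neg_le_abs _) hu.le
        _ ≤ |x' - x| / m := div_le_div_of_nonneg_left (abs_nonneg _) hm hx
    linarith

end SmallFactors

section OverlapColour

/-- `slyColourLimit α β e e e = (1-α-β)^{-e}`. [folklore] -/
theorem slyColourLimit_diag {α β : ℝ} (hα : α < 1) (hβ : β < 1) (hαβ : α + β < 1) (e : ℕ) :
    slyColourLimit α β e e e = 1 / (1 - α - β) ^ e := by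
  unfold slyColourLimit
  have h1 : (1 - α) ≠ 0 := ne_of_gt (sub_pos.2 hα)
  have h2 : (1 - β) ≠ 0 := ne_of_gt (sub_pos.2 hβ)
  have h3 : (1 - α - β) ≠ 0 := ne_of_gt (by linarith)
  rw [pow_add]
  field_simp

/-- **Per-colour overlap ratio bound** (all `e` planted edges of the colour treated as doubly occupied):
`[C(N-e-(b'-e), a'-e)/C(N-e, a'-e)] ≤ exp(32e²/m) (N/(N-a'-b'))^e · [C(N-b', a')/C(N, a')]`,
`m = min(a', N-a'-b')`. [cite: Sly2010, Lemma 3.8 (proof: overlapping configurations contribute `O(n^{-1})`)] -/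
theorem overlap_colour_choose_ratio_le (N e a' b' : ℕ) (heb : e ≤ b') (ha0 : 0 < a') (ha : 4 * e ≤ a')
    (hgap : 4 * e ≤ N - a' - b') (hab : a' + b' < N) :
    (((N - e - (b' - e)).choose (a' - e) : ℕ) : ℝ) / ((N - e).choose (a' - e) : ℕ) ≤
      Real.exp (32 * (e : ℝ) ^ 2 / min (a' : ℝ) ((N : ℝ) - a' - b')) * ((N : ℝ) / ((N : ℝ) - a' - b')) ^ e *
        ((((N - b').choose a' : ℕ) : ℝ) / (N.choose a' : ℕ)) := by
  have h := planted_colour_logratio N e e e a' b' le_rfl le_rfl heb ha0 ha hgap hab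
  have hNr : (0 : ℝ) < N := by exact_mod_cast (show 0 < N by omega)
  have hc1 : (0 : ℝ) < ((N - e - (b' - e)).choose (a' - e) : ℕ) := by
    exact_mod_cast Nat.choose_pos (by omega)
  have hc2 : (0 : ℝ) < ((N - e).choose (a' - e) : ℕ) := by exact_mod_cast Nat.choose_pos (by omega)
  have hc3 : (0 : ℝ) < ((N - b').choose a' : ℕ) := by exact_mod_cast Nat.choose_pos (by omega)
  have hc4 : (0 : ℝ) < (N.choose a' : ℕ) := by exact_mod_cast Nat.choose_pos (by omega)
  have hα : (a' : ℝ) / N < 1 := by rw [div_lt_one hNr]; exact_mod_cast (show a' < N by omega)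
  have hβ : (b' : ℝ) / N < 1 := by rw [div_lt_one hNr]; exact_mod_cast (show b' < N by omega)
  have hαβ : (a' : ℝ) / N + (b' : ℝ) / N < 1 := by
    rw [← add_div, div_lt_one hNr]; exact_mod_cast hab
  rw [slyColourLimit_diag hα hβ hαβ] at h
  have hgapr : (0 : ℝ) < (N : ℝ) - a' - b' := by
    have : ((a' + b' : ℕ) : ℝ) < N := by exact_mod_cast hab
    push_cast at this; linarith
  have hlim : (1 : ℝ) / (1 - (a' : ℝ) / N - (b' : ℝ) / N) ^ e = ((N : ℝ) / ((N : ℝ) - a' - b')) ^ e := by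
    rw [show (1 : ℝ) - (a' : ℝ) / N - (b' : ℝ) / N = ((N : ℝ) - a' - b') / N by field_simp, div_pow, div_pow, one_div_div]
  rw [hlim] at h
  have habs := (abs_le.1 h).2
  have hlog : Real.log ((((N - e - (b' - e)).choose (a' - e) : ℕ) : ℝ) / ((N - e).choose (a' - e) : ℕ)) ≤
      32 * (e : ℝ) ^ 2 / min (a' : ℝ) ((N : ℝ) - a' - b') + Real.log (((N : ℝ) / ((N : ℝ) - a' - b')) ^ e) +
        Real.log ((((N - b').choose a' : ℕ) : ℝ) / (N.choose a' : ℕ)) := by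
    rw [Real.log_div hc1.ne' hc2.ne', Real.log_div hc3.ne' hc4.ne']
    linarith
  have hpos : (0 : ℝ) < ((N : ℝ) / ((N : ℝ) - a' - b')) ^ e := by positivity
  calc (((N - e - (b' - e)).choose (a' - e) : ℕ) : ℝ) / ((N - e).choose (a' - e) : ℕ)
      = Real.exp (Real.log ((((N - e - (b' - e)).choose (a' - e) : ℕ) : ℝ) / ((N - e).choose (a' - e) : ℕ))) := by
        rw [Real.exp_log (div_pos hc1 hc2)]
    _ ≤ Real.exp (32 * (e : ℝ) ^ 2 / min (a' : ℝ) ((N : ℝ) - a' - b') + Real.log (((N : ℝ) / ((N : ℝ) - a' - b')) ^ e) +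
        Real.log ((((N - b').choose a' : ℕ) : ℝ) / (N.choose a' : ℕ))) := Real.exp_le_exp.2 hlog
    _ = _ := by
        rw [Real.exp_add, Real.exp_add, Real.exp_log hpos, Real.exp_log (div_pos hc3 hc4)]

/-- `1/N^{(e)} ≤ (2/N)^e` for `2e ≤ N`. [folklore] -/
theorem one_div_descFactorial_le (N e : ℕ) (hN : 0 < N) (he : 2 * e ≤ N) :
    (1 : ℝ) / (N.descFactorial e : ℝ) ≤ ((2 : ℝ) / N) ^ e := by
  have hNr : (0 : ℝ) < N := by exact_mod_cast hN
  have hlow : ((N : ℝ) / 2) ^ e ≤ (N.descFactorial e : ℝ) := by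
    have h1 : (((N - e : ℕ) : ℝ)) ^ e ≤ (N.descFactorial e : ℝ) := by
      have h0 := Nat.pow_sub_le_descFactorial N e
      have h0' : (N - e) ^ e ≤ (N + 1 - e) ^ e := Nat.pow_le_pow_left (by omega) e
      exact_mod_cast h0'.trans h0
    have h2 : (N : ℝ) / 2 ≤ ((N - e : ℕ) : ℝ) := by
      rw [Nat.cast_sub (by omega)]
      have : ((2 * e : ℕ) : ℝ) ≤ N := by exact_mod_cast he
      push_cast at this; linarith
    exact (pow_le_pow_left₀ (by positivity) h2 e).trans h1
  have hpos : (0 : ℝ) < ((N : ℝ) / 2) ^ e := by positivity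
  calc (1 : ℝ) / (N.descFactorial e : ℝ) ≤ 1 / ((N : ℝ) / 2) ^ e := one_div_le_one_div_of_le hpos hlow
    _ = ((2 : ℝ) / N) ^ e := by rw [one_div, ← inv_pow, inv_div]

end OverlapColour

end Literature.Computability.Complexity
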